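import Mathlib.LinearAlgebra.Matrix.Determinant.Basic
import Literature.RingTheory.MvPolynomial.KaltofenNoetherFormsGeneric
import HarnessLib

/-!
# Towards Kaltofen's Theorem 7 (effective Noether forms): proofs — degrees in the `c`'s

Sibling proof file of `KaltofenNoetherFormsGeneric.lean` (E. Kaltofen, J. Comput. System Sci.
50 (1995) 274–295, §5 proof of Thm. 7, p. 25: "Finally, we estimate the degrees … We have by
(30) and (31), `deg_{c's}(λ) = 1`, `deg_{c's}(ρ̄) ≤ 2d − 1 ⟹ deg_{c's}(σ) ≤ 2d − 1`, and, since
the degree in the `c`'s of the generic version of `φ₂` is equal to `1`, `deg_{c's}(τ) ≤ D`.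
Hence, `deg_{c's}(Φ_t) ≤ D + 2d`"). In `GenRing n = ℤ[params][c]` the degree in the `c`'s is
`MvPolynomial.totalDegree`; this file proves

* `totalDegree_extract_le` — the forms `σ`, `τ` have degree `≤` that of `ρ̄`, `λ^D Δ'`;
* `totalDegree_coeff_gline_le` (`≤ 1`), `totalDegree_bivCoeff_le` (`≤ 1`), `totalDegree_lam_le`
  (`≤ 1`);
* `totalDegree_rhoBar_le` — `deg_{c's} ρ̄ ≤ 2d − 1` (a Sylvester determinant of size `2d − 1`
  with entries of degree `≤ 1`);
* `totalDegree_clearedEval_le` — `deg_{c's} (λ^D Δ') ≤ D` for `deg Δ ≤ D`.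

No definitions, no named facts.

## References

* E. Kaltofen, J. Comput. System Sci. 50 (1995) 274–295, §4 (30)–(31), §5 proof of Thm. 7.
  [Kaltofen1995]
-/

noncomputable section

open MvPolynomial
open scoped Polynomial

namespace Literature.RingTheory.MvPolynomial

namespace KaltofenGeneric

/-! ### Degrees of coefficients of polynomials over `A[X_σ]` -/

section CoeffDeg

variable {A : Type*} [CommRing A] {σ : Type*}

/-- Coefficient-degree bound for a product (one level). [folklore] -/
theorem coeffDeg_mul {p q : Polynomial (MvPolynomial σ A)} {k l : ℕ}
    (hp : ∀ i, (p.coeff i).totalDegree ≤ k) (hq : ∀ i, (q.coeff i).totalDegree ≤ l) :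
    ∀ i, ((p * q).coeff i).totalDegree ≤ k + l := by
  intro i
  rw [Polynomial.coeff_mul]
  refine totalDegree_finsetSum_le fun x _ => ?_
  exact (totalDegree_mul _ _).trans (Nat.add_le_add (hp _) (hq _))

/-- Coefficient-degree bound for a sum. [folklore] -/
theorem coeffDeg_add {p q : Polynomial (MvPolynomial σ A)} {k : ℕ}
    (hp : ∀ i, (p.coeff i).totalDegree ≤ k) (hq : ∀ i, (q.coeff i).totalDegree ≤ k) :
    ∀ i, ((p + q).coeff i).totalDegree ≤ k := fun i => by
  rw [Polynomial.coeff_add]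
  exact (totalDegree_add _ _).trans (max_le (hp i) (hq i))

/-- Coefficient-degree bound for a finite sum. [folklore] -/
theorem coeffDeg_sum {ι : Type*} (s : Finset ι) {p : ι → Polynomial (MvPolynomial σ A)} {k : ℕ}
    (hp : ∀ x ∈ s, ∀ i, ((p x).coeff i).totalDegree ≤ k) :
    ∀ i, ((∑ x ∈ s, p x).coeff i).totalDegree ≤ k := by
  classical
  induction s using Finset.induction_on with
  | empty => intro i; simp
  | insert x s hx ih =>
    rw [Finset.sum_insert hx]
    exact coeffDeg_add (hp x (Finset.mem_insert_self _ _)) (ih fun y hy => hp y (Finset.mem_insert_of_mem hy))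

/-- Coefficients of degree `0` are stable under products. [folklore] -/
theorem coeffDeg_prod_zero {ι : Type*} (s : Finset ι) {p : ι → Polynomial (MvPolynomial σ A)}
    (hp : ∀ x ∈ s, ∀ i, ((p x).coeff i).totalDegree ≤ 0) :
    ∀ i, ((∏ x ∈ s, p x).coeff i).totalDegree ≤ 0 := by
  classical
  induction s using Finset.induction_on with
  | empty => intro i; rw [Finset.prod_empty, Polynomial.coeff_one]; split_ifs <;> simp
  | insert x s hx ih =>
    rw [Finset.prod_insert hx]
    have := coeffDeg_mul (hp x (Finset.mem_insert_self _ _)) (ih fun y hy => hp y (Finset.mem_insert_of_mem hy))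
    simpa using this

/-- Coefficients of degree `0` are stable under powers. [folklore] -/
theorem coeffDeg_pow_zero {p : Polynomial (MvPolynomial σ A)} (hp : ∀ i, (p.coeff i).totalDegree ≤ 0) (k : ℕ) :
    ∀ i, ((p ^ k).coeff i).totalDegree ≤ 0 := by
  induction k with
  | zero => intro i; rw [pow_zero, Polynomial.coeff_one]; split_ifs <;> simp
  | succ k ih => rw [pow_succ]; have := coeffDeg_mul ih hp; simpa using this

/-- Coefficient degrees of a constant. [folklore] -/
theorem coeffDeg_C (a : MvPolynomial σ A) : ∀ i, ((Polynomial.C a).coeff i).totalDegree ≤ a.totalDegree := by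
  intro i
  rw [Polynomial.coeff_C]
  split_ifs <;> simp

/-- Coefficient degrees of `C a * X`. [folklore] -/
theorem coeffDeg_C_mul_X (a : MvPolynomial σ A) :
    ∀ i, ((Polynomial.C a * Polynomial.X).coeff i).totalDegree ≤ a.totalDegree := by
  intro i
  rw [Polynomial.coeff_C_mul_X]
  split_ifs <;> simp

end CoeffDeg

/-! ### Two-level coefficient degrees (bivariate polynomials over `A[X_σ]`) -/

section CoeffDeg2

variable {A : Type*} [CommRing A] {σ : Type*}

/-- Two-level coefficient-degree bound for a product. [folklore] -/
theorem coeffDeg2_mul {P Q : Polynomial (Polynomial (MvPolynomial σ A))} {k l : ℕ}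
    (hP : ∀ i j, ((P.coeff i).coeff j).totalDegree ≤ k) (hQ : ∀ i j, ((Q.coeff i).coeff j).totalDegree ≤ l) :
    ∀ i j, (((P * Q).coeff i).coeff j).totalDegree ≤ k + l := by
  intro i j
  rw [Polynomial.coeff_mul, Polynomial.finsetSum_coeff]
  refine totalDegree_finsetSum_le fun x _ => ?_
  exact coeffDeg_mul (hP x.1) (hQ x.2) j

/-- Two-level bound for a sum. [folklore] -/
theorem coeffDeg2_add {P Q : Polynomial (Polynomial (MvPolynomial σ A))} {k : ℕ}
    (hP : ∀ i j, ((P.coeff i).coeff j).totalDegree ≤ k) (hQ : ∀ i j, ((Q.coeff i).coeff j).totalDegree ≤ k) :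
    ∀ i j, (((P + Q).coeff i).coeff j).totalDegree ≤ k := fun i j => by
  rw [Polynomial.coeff_add, Polynomial.coeff_add]
  exact (totalDegree_add _ _).trans (max_le (hP i j) (hQ i j))

/-- Two-level bound for a finite sum. [folklore] -/
theorem coeffDeg2_sum {ι : Type*} (s : Finset ι) {P : ι → Polynomial (Polynomial (MvPolynomial σ A))} {k : ℕ}
    (hP : ∀ x ∈ s, ∀ i j, (((P x).coeff i).coeff j).totalDegree ≤ k) :
    ∀ i j, (((∑ x ∈ s, P x).coeff i).coeff j).totalDegree ≤ k := by
  classical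
  induction s using Finset.induction_on with
  | empty => intro i j; simp
  | insert x s hx ih =>
    rw [Finset.sum_insert hx]
    exact coeffDeg2_add (hP x (Finset.mem_insert_self _ _)) (ih fun y hy => hP y (Finset.mem_insert_of_mem hy))

/-- Two-level: degree-`0` coefficients are stable under products. [folklore] -/
theorem coeffDeg2_prod_zero {ι : Type*} (s : Finset ι) {P : ι → Polynomial (Polynomial (MvPolynomial σ A))}
    (hP : ∀ x ∈ s, ∀ i j, (((P x).coeff i).coeff j).totalDegree ≤ 0) :
    ∀ i j, (((∏ x ∈ s, P x).coeff i).coeff j).totalDegree ≤ 0 := by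
  classical
  induction s using Finset.induction_on with
  | empty =>
    intro i j
    rw [Finset.prod_empty, Polynomial.coeff_one]
    split_ifs
    · rw [Polynomial.coeff_one]; split_ifs <;> simp
    · simp
  | insert x s hx ih =>
    rw [Finset.prod_insert hx]
    have := coeffDeg2_mul (hP x (Finset.mem_insert_self _ _)) (ih fun y hy => hP y (Finset.mem_insert_of_mem hy))
    simpa using this

/-- Two-level: degree-`0` coefficients are stable under powers. [folklore] -/
theorem coeffDeg2_pow_zero {P : Polynomial (Polynomial (MvPolynomial σ A))}
    (hP : ∀ i j, ((P.coeff i).coeff j).totalDegree ≤ 0) (k : ℕ) :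
    ∀ i j, (((P ^ k).coeff i).coeff j).totalDegree ≤ 0 := by
  induction k with
  | zero =>
    intro i j
    rw [pow_zero, Polynomial.coeff_one]
    split_ifs
    · rw [Polynomial.coeff_one]; split_ifs <;> simp
    · simp
  | succ k ih => rw [pow_succ]; have := coeffDeg2_mul ih hP; simpa using this

/-- Two-level degrees of `C p`. [folklore] -/
theorem coeffDeg2_C {p : Polynomial (MvPolynomial σ A)} {k : ℕ} (hp : ∀ j, (p.coeff j).totalDegree ≤ k) :
    ∀ i j, (((Polynomial.C p).coeff i).coeff j).totalDegree ≤ k := by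
  intro i j
  rw [Polynomial.coeff_C]
  split_ifs
  · exact hp j
  · simp

/-- Two-level degrees of `C p * X`. [folklore] -/
theorem coeffDeg2_C_mul_X {p : Polynomial (MvPolynomial σ A)} {k : ℕ} (hp : ∀ j, (p.coeff j).totalDegree ≤ k) :
    ∀ i j, (((Polynomial.C p * Polynomial.X).coeff i).coeff j).totalDegree ≤ k := by
  intro i j
  rw [Polynomial.coeff_C_mul_X]
  split_ifs
  · exact hp j
  · simp

end CoeffDeg2

/-! ### The forms have the degree of the object they are extracted from -/

variable {n d : ℕ}

/-- **`deg_{c's} σ ≤ deg_{c's} ρ̄`, `deg_{c's} τ ≤ deg_{c's} (λ^D Δ')`:** an extracted form has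
total degree at most that of the element it is extracted from. [cite: Kaltofen1995, §5 proof of Thm. 7 ("deg_{c's}(ρ̄) ≤ 2d−1 ⟹ deg_{c's}(σ) ≤ 2d−1")] -/
theorem totalDegree_extract_le (F : GenRing n) (m : Params n →₀ ℕ) :
    (extract F m).totalDegree ≤ F.totalDegree := by
  classical
  rw [extract]
  refine totalDegree_finsetSum_le fun e he => ?_
  refine (totalDegree_monomial_le _ _).trans ?_
  exact le_totalDegree he

/-! ### `deg_{c's}` of the generic line and plane sections is `1` -/

/-- The parameters are constants in the `c`'s. [folklore] -/
theorem totalDegree_μv (i : Fin n) : (μv n i).totalDegree = 0 := totalDegree_C _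

/-- The parameters are constants in the `c`'s. [folklore] -/
theorem totalDegree_vv (i : Fin n) : (vv n i).totalDegree = 0 := totalDegree_C _

/-- The parameters are constants in the `c`'s. [folklore] -/
theorem totalDegree_zv (i : Fin n) : (zv n i).totalDegree = 0 := totalDegree_C _

/-- The generic line/plane sections expand over the monomials of `fgen`. [folklore] -/
theorem aeval_fgen_eq_sum {S : Type*} [CommSemiring S] [Algebra (GenRing n) S] (θ : Fin n → S) :
    MvPolynomial.aeval θ (fgen n d) = ∑ e ∈ exps n d, algebraMap (GenRing n) S (X e) * ∏ i, θ i ^ e i := by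
  rw [fgen, map_sum]
  refine Finset.sum_congr rfl fun e _ => ?_
  rw [aeval_monomial, Finsupp.prod_fintype _ _ fun i => pow_zero _]

/-- **`deg_{c's}` of the coefficients of the generic line section `g` is `≤ 1`.**
[cite: Kaltofen1995, §5 proof of Thm. 7 ("the degree in the c's of the generic version of φ₂ is equal to 1")] -/
theorem totalDegree_coeff_gline_le (k : ℕ) : ((gline n d).coeff k).totalDegree ≤ 1 := by
  rw [gline, aeval_fgen_eq_sum]
  refine coeffDeg_sum _ (fun e _ => ?_) k
  have h1 : ∀ i, ((algebraMap (GenRing n) (Polynomial (GenRing n)) (X e)).coeff i).totalDegree ≤ 1 := by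
    intro i
    rw [Polynomial.algebraMap_apply, Algebra.algebraMap_self_apply]
    exact (coeffDeg_C (X e) i).trans (by rw [totalDegree_X])
  have h2 : ∀ i, ((∏ x : Fin n, (Polynomial.C (μv n x) + Polynomial.C (vv n x) * Polynomial.X) ^ e x).coeff i).totalDegree
      ≤ 0 := by
    refine coeffDeg_prod_zero _ fun x _ => coeffDeg_pow_zero ?_ _
    refine coeffDeg_add (fun i => (coeffDeg_C _ i).trans ?_) (fun i => (coeffDeg_C_mul_X _ i).trans ?_)
    · rw [totalDegree_μv]
    · rw [totalDegree_vv]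
  have := coeffDeg_mul h1 h2
  simpa using this

/-- **`deg_{c's}` of the coefficients `N_b` of the generic plane section `φ₂` is `≤ 1`.**
[cite: Kaltofen1995, §5 proof of Thm. 7 ("the degree in the c's of the generic version of φ₂ is equal to 1")] -/
theorem totalDegree_bivCoeff_le (b : ℕ × ℕ) : (bivCoeff n d b).totalDegree ≤ 1 := by
  rw [bivCoeff, planeGen, aeval_fgen_eq_sum]
  refine coeffDeg2_sum _ (fun e _ => ?_) b.1 b.2
  have h1 : ∀ i j, (((algebraMap (GenRing n) (Polynomial (Polynomial (GenRing n))) (X e)).coeff i).coeff j).totalDegree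
      ≤ 1 := by
    intro i j
    rw [Polynomial.algebraMap_apply, Polynomial.algebraMap_apply, Algebra.algebraMap_self_apply]
    exact (coeffDeg2_C (coeffDeg_C (X e)) i j).trans (by rw [totalDegree_X])
  have h2 : ∀ i j, (((∏ x : Fin n, ((Polynomial.C (Polynomial.C (μv n x)) +
      Polynomial.C (Polynomial.C (vv n x)) * Polynomial.X +
        Polynomial.C (Polynomial.C (zv n x) * Polynomial.X) : Polynomial (Polynomial (GenRing n)))) ^ e x).coeff i).coeff j).totalDegree
      ≤ 0 := by
    refine coeffDeg2_prod_zero _ fun x _ => coeffDeg2_pow_zero ?_ _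
    have hμ : ∀ j, ((Polynomial.C (μv n x) : Polynomial (GenRing n)).coeff j).totalDegree ≤ 0 :=
      fun j => (coeffDeg_C _ j).trans (by rw [totalDegree_μv])
    have hv : ∀ j, ((Polynomial.C (vv n x) : Polynomial (GenRing n)).coeff j).totalDegree ≤ 0 :=
      fun j => (coeffDeg_C _ j).trans (by rw [totalDegree_vv])
    have hz : ∀ j, ((Polynomial.C (zv n x) * Polynomial.X : Polynomial (GenRing n)).coeff j).totalDegree ≤ 0 :=
      fun j => (coeffDeg_C_mul_X _ j).trans (by rw [totalDegree_zv])
    exact coeffDeg2_add (coeffDeg2_add (coeffDeg2_C hμ) (coeffDeg2_C_mul_X hv)) (coeffDeg2_C hz)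
  have := coeffDeg2_mul h1 h2
  simpa using this

/-- **`deg_{c's} λ ≤ 1`** (Kaltofen: "`deg_{c's}(λ) = 1`"). [cite: Kaltofen1995, §5 proof of Thm. 7] -/
theorem totalDegree_lam_le : (lam n d).totalDegree ≤ 1 := by
  rw [lam]
  refine totalDegree_finsetSum_le fun e _ => ?_
  refine (totalDegree_mul _ _).trans ?_
  rw [totalDegree_X]
  have : (∏ i, vv n i ^ e i).totalDegree ≤ 0 := by
    refine (totalDegree_finsetProd _ _).trans ?_
    refine (Finset.sum_le_sum (fun i _ => totalDegree_pow (vv n i) (e i))).trans ?_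
    simp [totalDegree_vv]
  omega

/-! ### `deg_{c's} ρ̄ ≤ 2d − 1` -/

/-- Entries of a Sylvester matrix are coefficients (or zero). [folklore] -/
theorem forall_sylvester {R : Type*} [CommRing R] (P : R → Prop) (h0 : P 0) (f g : R[X]) (m k : ℕ)
    (hf : ∀ i, P (f.coeff i)) (hg : ∀ i, P (g.coeff i)) : ∀ i j, P (Polynomial.sylvester f g m k i j) := by
  intro i j
  induction j using Fin.addCases with
  | left j => simp only [Polynomial.sylvester, Matrix.of_apply, Fin.addCases_left]; split_ifs <;> simp [hg, h0]
  | right j => simp only [Polynomial.sylvester, Matrix.of_apply, Fin.addCases_right]; split_ifs <;> simp [hf, h0]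

/-- The derivative does not raise `deg_{c's}` of the coefficients. [folklore] -/
theorem totalDegree_coeff_derivative_le {A : Type*} [CommRing A] {σ : Type*} {p : Polynomial (MvPolynomial σ A)}
    {k : ℕ} (hp : ∀ i, (p.coeff i).totalDegree ≤ k) : ∀ i, ((Polynomial.derivative p).coeff i).totalDegree ≤ k := by
  intro i
  rw [Polynomial.coeff_derivative]
  refine (totalDegree_mul _ _).trans ?_
  have : ((i : MvPolynomial σ A) + 1).totalDegree = 0 := by
    rw [← Nat.cast_succ, ← map_natCast (C : A →+* MvPolynomial σ A), totalDegree_C]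
  rw [this, add_zero]
  exact hp _

/-- Degree of a determinant with a uniform entry bound (the tree's `totalDegree_det_le_sum`,
restated for the `Fin` instances of `Polynomial.resultant`). [folklore] -/
theorem totalDegree_det_le_card_mul {A : Type*} [CommRing A] {σ : Type*} {ι : Type*} [Fintype ι] [DecidableEq ι]
    (N : Matrix ι ι (MvPolynomial σ A)) {r : ℕ} (hN : ∀ i j, (N i j).totalDegree ≤ r) :
    N.det.totalDegree ≤ Fintype.card ι * r := by
  rw [Matrix.det_apply']
  refine totalDegree_finsetSum_le fun τ _ => ?_
  refine (totalDegree_mul _ _).trans ?_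
  have hsign : ((Equiv.Perm.sign τ : ℤ) : MvPolynomial σ A).totalDegree = 0 := by
    rcases Int.units_eq_one_or (Equiv.Perm.sign τ) with h | h <;> simp [h]
  rw [hsign, zero_add]
  refine (totalDegree_finsetProd _ _).trans ?_
  calc ∑ i, (N (τ i) i).totalDegree ≤ ∑ _i : ι, r := Finset.sum_le_sum fun i _ => hN _ _
    _ = Fintype.card ι * r := by rw [Finset.sum_const, Finset.card_univ, smul_eq_mul]

/-- **`deg_{c's} ρ̄ ≤ 2d − 1`** (Kaltofen: "`deg_{c's}(ρ̄) ≤ 2d − 1`"): `ρ̄` is a Sylvester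
determinant of size `d + (d − 1)` whose entries have degree `≤ 1` in the `c`'s. [cite: Kaltofen1995, §5 proof of Thm. 7] -/
theorem totalDegree_rhoBar_le : (rhoBar n d).totalDegree ≤ d + (d - 1) := by
  rw [rhoBar, Polynomial.resultant]
  have h := totalDegree_det_le_card_mul (Polynomial.sylvester (gline n d) (Polynomial.derivative (gline n d)) d (d - 1))
    (forall_sylvester (fun x : GenRing n => x.totalDegree ≤ 1) (by simp) _ _ _ _
      totalDegree_coeff_gline_le (totalDegree_coeff_derivative_le totalDegree_coeff_gline_le))
  rwa [Fintype.card_fin, mul_one] at h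

/-! ### `deg_{c's} (λ^D Δ') ≤ D` -/

/-- Evaluating a homogeneous form of degree `k` at arguments of degree `≤ 1` gives degree `≤ k`.
[folklore] -/
theorem totalDegree_aeval_le_of_isHomogeneous {R : Type*} [CommRing R] {σ τ : Type*} {A : Type*} [CommRing A]
    [Algebra A (MvPolynomial σ R)]
    {p : MvPolynomial τ A} {k : ℕ} (hp : p.IsHomogeneous k) (N : τ → MvPolynomial σ R)
    (hN : ∀ b, (N b).totalDegree ≤ 1) (hC : ∀ a : A, (algebraMap A (MvPolynomial σ R) a).totalDegree = 0) :
    (MvPolynomial.aeval N p).totalDegree ≤ k := by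
  classical
  conv_lhs => rw [p.as_sum]
  rw [map_sum]
  refine totalDegree_finsetSum_le fun m hm => ?_
  rw [aeval_monomial]
  refine (totalDegree_mul _ _).trans ?_
  rw [hC, zero_add]
  have hdeg : m.degree = k := by
    rw [Finsupp.degree_eq_weight_one]; exact hp (mem_support_iff.1 hm)
  rw [Finsupp.prod]
  refine (totalDegree_finsetProd _ _).trans ?_
  calc ∑ b ∈ m.support, (N b ^ m b).totalDegree ≤ ∑ b ∈ m.support, m b := by
        refine Finset.sum_le_sum fun b _ => (totalDegree_pow _ _).trans ?_
        calc m b * (N b).totalDegree ≤ m b * 1 := Nat.mul_le_mul_left _ (hN b)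
          _ = m b := mul_one _
    _ = k := by rw [← hdeg, Finsupp.degree_apply]

/-- **`deg_{c's} (λ^D Δ') ≤ D`** for `deg Δ ≤ D` (Kaltofen: "since the degree in the `c`'s of
the generic version of `φ₂` is equal to `1`, `deg_{c's}(τ) ≤ D`"). [cite: Kaltofen1995, §5 proof of Thm. 7] -/
theorem totalDegree_clearedEval_le (D : ℕ) (Δ : MvPolynomial (ℕ × ℕ) ℤ) :
    (clearedEval n d D Δ).totalDegree ≤ D := by
  rw [clearedEval]
  refine totalDegree_finsetSum_le fun k hk => ?_
  rw [Finset.mem_range] at hk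
  refine (totalDegree_mul _ _).trans ?_
  have h1 : (lam n d ^ (D - k)).totalDegree ≤ D - k :=
    (totalDegree_pow _ _).trans (by simpa using Nat.mul_le_mul_left (D - k) (totalDegree_lam_le (n := n) (d := d)))
  have h2 : (MvPolynomial.aeval (bivCoeff n d) (homogeneousComponent k Δ)).totalDegree ≤ k :=
    totalDegree_aeval_le_of_isHomogeneous (homogeneousComponent_isHomogeneous k Δ) _ (totalDegree_bivCoeff_le)
      fun a => by rw [show algebraMap ℤ (GenRing n) a = C (C a) from rfl, totalDegree_C]
  omega

end KaltofenGeneric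

end Literature.RingTheory.MvPolynomial

end
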